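import Summits.BirchSwinnertonDyer.BirchSwinnertonDyer.Theorems.ThetaPartnerAtTwoSignedKatoUpToAtTwoPointsModelJ
import Literature.NumberTheory.EllipticCurves.Sprung2012.LocalIwasawaModule
import Literature.NumberTheory.EllipticCurves.Kato2004.IwasawaCohomology
import Literature.NumberTheory.EllipticCurves.IwasawaAlgebraCharIdealProofs
import HarnessLib

/-!
# Route `ThetaPartnerAtTwo` (TP2), crux K3 `SignedKatoDivisibilityUpToAtTwo` (item stmt-BirchSwinnertonDyer-20308),
# line `colemanrat` v5 — THE THREE INTERFACES between the points package of (R2^ι) and its research residue: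
# (Rec) reciprocity ⟸ finite-level orthogonality on Kummer witnesses; `col := q ∘ col₀` is `Λ`-LINEAR; (Z) the zeta
# bound ⟸ an explicit-reciprocity-shaped identity `p^a · G = w · p^b · L`

Width seat `bsd-wall-tp2-p2x-w2` g3 (cell `bsd-wall`). HONEST FRAMING: THEOREMS ONLY — no definition, no named fact, no
instance, no `sorry`; route-independent (no `Theses`/`Cruxes` import); closes no item; everything research-grade (the
`T_pE`-adic local Tate pairing, Poitou–Tate, Kato's explicit reciprocity law at `2`) stays a HYPOTHESIS. BSD is NOT proved by
any of this.

## Why this file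

The lead's points package `KummerPoint.exists_pointsPackage_two` (file `…PointsPackage.lean`) delivers the `P`-side of the
registered stub (R2^ι): `P = Hom(E(ℚ_{2,∞}·ℚ_v), ℤ₂) ⧸ Ker Col♭`, `ι_P = Col♭`, a `Λ`-compatible projection `q`, and
`j = j₀ ∘ res_{A⁺}` with the Kummer VALUE FORMULA of the points-model `j₀` (`KummerPoint.exists_pointsModelJ[_two]`:
`D.toDual (j₀ φ_A) s = (φ_A(p^k Q) mod p^k) • p^{-k}` for every Kummer witness `(φ, Q, k)` of `s ∈ Sel^ε`). What remains
(lead memo `G4-LEAD-v5.md` §3) is `col₀ : 𝐇¹ → Hom(E_∞, ℤ_p)` (definition item (D); its glue and `Λ`-linearity are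
`…ColGlue.lean`), the RECIPROCITY `j (col x) = 0` (Poitou–Tate along `ℚ_∞`) and the ZETA BOUND (explicit reciprocity at `2`).
This file states, in the kernel, exactly WHAT those two research items must output for the package to close:
* (Rec) — §1: `j₀ φ_A = 0` as soon as `φ_A(p^k Q) ≡ 0 (mod p^k)` for every Kummer witness `(φ, Q, k)` of every class of
  `Sel^ε(E/K_∞)` (every class HAS a witness relative to `A^ε = ⨆ₙ E^ε(K_n·K_v)`: K4's
  `SignedEC.signedSelmerInfty_le_localKummerOverOfEmb_iSup_signedLocalPoints`; `D.toDual` is injective) — so Poitou–Tate has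
  to be delivered only as the FINITE-LEVEL orthogonality «`⟨proj n x, p^k Q⟩_n ∈ p^k ℤ_p`», and with an exponent `p^m` for the
  `2`-robust form;
* (Lin) — §2: `col := q ∘ col₀` is `Λ`-LINEAR when `q` and `col₀` are `Λ`-compatible for Sprung's `lambdaSMul` (the package's
  clause for `q`, `ColGlue.col_smul_eq_lambdaSMul` for `col₀`);
* (Z) — §3: `ℓ_𝔭(Λ/(G)) = ℓ_𝔭(Λ/(L))` at every prime `𝔭 ∌ p` whenever `C(p)^a · G = w · C(p)^b · L` with `w ∈ Λˣ` — the shape in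
  which an explicit reciprocity law «`Col♭(col z_Kato) = (unit) · (p-power) · L♭`» (Kato Thm. 12.5 / Kobayashi Thm. 6.3 / Otsuki
  2009 at `p = 2`) feeds the zeta clause `ℓ_𝔭(Λ/(ι_P (col s))) ≤ ℓ_𝔭(Λ/(L♭))` of (R2^ι).

## What is proved
* §1 `toDual_pointsModelJ_apply_eq_zero_of_witness`, **`pointsModelJ_eq_zero_of_forall_witness`**,
  `pointsModelJ_nsmul_eq_zero_of_forall_witness` (any number field `K`, prime `p`, sign `ε`, place `v ∋ p`, pinned `D`).
* §2 **`exists_linearMap_comp_of_lambdaSMul`** (any `p`, pinned `I`, local field `E`, local generator lift `g`).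
* §3 `lengthAt_quotient_span_C_pow_mul_eq`, **`lengthAt_quotient_span_eq_of_C_pow_mul_eq_unit_mul`**,
  `lengthAt_quotient_span_le_of_C_pow_mul_eq_unit_mul`.

References: [Kobayashi2003] (7.17)–(7.21) (pp. 12–13), Thm. 6.3 (p. 11), (8.23); [Kato2004Asterisque] Thm. 12.5 (p. 222), §17.13
(p. 279); [Sprung2012] Def. 5.9, Def. 6.1, Prop. 7.19; [Washington1997] §13.2; [MilneADT2006] Ch. I Thm. 4.10.
-/

set_option autoImplicit false
-- the Theorems namespace of this sub repeats the summit name by design (D-0017 nested layout)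
set_option linter.dupNamespace false

noncomputable section

open scoped Classical

namespace Summit.BirchSwinnertonDyer.BirchSwinnertonDyer.Theorems

namespace SignedKatoOffTwo.RecInterface

open NumberField IsDedekindDomain Field WeierstrassCurve
  Literature.NumberTheory.EllipticCurves Literature.NumberTheory.EllipticCurves.Kobayashi2003
  Literature.NumberTheory.EllipticCurves.GreenbergSelmer Literature.NumberTheory.EllipticCurves.Module
  Literature.NumberTheory.EllipticCurves.Sprung2012 Literature.NumberTheory.GaloisRepresentations ZpExtension
  Literature.NumberTheory.EllipticCurves.Rank1Residual Literature.NumberTheory.EllipticCurves.Kato2004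
  Literature.NumberTheory.EllipticCurves.Kato2004.EulerSystemValues

universe u

/-! ## §1 (Rec): reciprocity from finite-level orthogonality on Kummer witnesses -/

section Rec

variable {K : Type u} [Field K] [NumberField K] (W : WeierstrassCurve K) (p : ℕ) [Fact p.Prime]
  (κ : ZpExtension K p) {γ : absoluteGaloisGroup K} (ε : ℤˣ) (v : HeightOneSpectrum (𝓞 K))
  (D : SignedSelmerDualData W κ γ ε)
  (j : (↥(⨆ n, signedLocalPoints κ (v.adicCompletion K) W ε n) →+ ℤ_[p]) →+ D.X)

/-- **One class.** For the points-model `j₀` (value formula on Kummer witnesses) and a functional `φ_A` on `A^ε = ⨆ₙ E^ε(K_n·K_v)`: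
if `s ∈ Sel^ε(E/K_∞)` has a Kummer witness `(φ, Q, k)` relative to `A^ε` with `φ_A(p^k Q) ≡ 0 (mod p^k)`, then the character
`D.toDual (j₀ φ_A)` kills `s`. [cite: Kobayashi2003, (7.17) (p. 12), (8.23) (p. 18)] -/
theorem toDual_pointsModelJ_apply_eq_zero_of_witness
    (hj : ∀ (φA : ↥(⨆ n, signedLocalPoints κ (v.adicCompletion K) W ε n) →+ ℤ_[p])
        (s : W.subgroupH1 p κ.kerSubgroup) (hs : s ∈ signedSelmerInfty W κ ε)
        (φ : contOneCocycles (discreteTopRep κ.kerSubgroup (W.geomPrimaryTorsion p)))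
        (Q : localPoints W (v.adicCompletion K)) (k : ℕ)
        (_ : oneCocycleClass _ φ = s) (hQ : p ^ k • Q ∈ (⨆ n, signedLocalPoints κ (v.adicCompletion K) W ε n))
        (_ : ∀ τ : localSubgroupOfEmb κ.kerSubgroup (closureEmb (K := K) (v.adicCompletion K)),
          pointsMapOfEmb W (closureEmb (K := K) (v.adicCompletion K))
              ((φ.1 (resGalSubgroupOfEmb κ.kerSubgroup _ τ) : W.geomPrimaryTorsion p) : W.geomPoints) =
            (τ : absoluteGaloisGroup (v.adicCompletion K)) • Q - Q),
        D.toDual (j φA) ⟨s, hs⟩ =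
          (PadicInt.toZModPow k (φA ⟨p ^ k • Q, hQ⟩)).val • ((((p : ℚ) ^ k)⁻¹ : ℚ) : AddCircle (1 : ℚ)))
    (φA : ↥(⨆ n, signedLocalPoints κ (v.adicCompletion K) W ε n) →+ ℤ_[p])
    {s : W.subgroupH1 p κ.kerSubgroup} (hs : s ∈ signedSelmerInfty W κ ε)
    (φ : contOneCocycles (discreteTopRep κ.kerSubgroup (W.geomPrimaryTorsion p)))
    (Q : localPoints W (v.adicCompletion K)) (k : ℕ) (hφ : oneCocycleClass _ φ = s)
    (hQ : p ^ k • Q ∈ (⨆ n, signedLocalPoints κ (v.adicCompletion K) W ε n))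
    (hτ : ∀ τ : localSubgroupOfEmb κ.kerSubgroup (closureEmb (K := K) (v.adicCompletion K)),
      pointsMapOfEmb W (closureEmb (K := K) (v.adicCompletion K))
          ((φ.1 (resGalSubgroupOfEmb κ.kerSubgroup _ τ) : W.geomPrimaryTorsion p) : W.geomPoints) =
        (τ : absoluteGaloisGroup (v.adicCompletion K)) • Q - Q)
    (h0 : PadicInt.toZModPow k (φA ⟨p ^ k • Q, hQ⟩) = 0) :
    D.toDual (j φA) ⟨s, hs⟩ = 0 := by
  rw [hj φA s hs φ Q k hφ hQ hτ, h0, ZMod.val_zero, zero_smul]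

/-- **(Rec) from finite-level orthogonality.** If `φ_A(p^k Q) ≡ 0 (mod p^k)` for EVERY Kummer witness `(φ, Q, k)` (relative to
`A^ε = ⨆ₙ E^ε(K_n·K_v)` at the chosen place above `v ∋ p`) of EVERY class `s ∈ Sel^ε(E/K_∞)`, then `j₀ φ_A = 0`: every class
has such a witness (`SignedEC.signedSelmerInfty_le_localKummerOverOfEmb_iSup_signedLocalPoints`), so the character
`D.toDual (j₀ φ_A)` vanishes identically, and `D.toDual` is injective. With `φ_A = (col₀ x)|_{A^ε}` this is the RECIPROCITY clause
`j (col x) = 0` of the package reduced to «`⟨proj n x, p^k Q⟩_n ∈ p^k ℤ_p`» — what Poitou–Tate along `K_∞` must deliver.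
[cite: Kobayashi2003, (7.17)–(7.20) (p. 12)] [cite: Kato2004Asterisque, §17.13 (p. 279)] [cite: MilneADT2006, Ch. I, Thm. 4.10] -/
theorem pointsModelJ_eq_zero_of_forall_witness (hv : (p : 𝓞 K) ∈ v.asIdeal)
    (hj : ∀ (φA : ↥(⨆ n, signedLocalPoints κ (v.adicCompletion K) W ε n) →+ ℤ_[p])
        (s : W.subgroupH1 p κ.kerSubgroup) (hs : s ∈ signedSelmerInfty W κ ε)
        (φ : contOneCocycles (discreteTopRep κ.kerSubgroup (W.geomPrimaryTorsion p)))
        (Q : localPoints W (v.adicCompletion K)) (k : ℕ)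
        (_ : oneCocycleClass _ φ = s) (hQ : p ^ k • Q ∈ (⨆ n, signedLocalPoints κ (v.adicCompletion K) W ε n))
        (_ : ∀ τ : localSubgroupOfEmb κ.kerSubgroup (closureEmb (K := K) (v.adicCompletion K)),
          pointsMapOfEmb W (closureEmb (K := K) (v.adicCompletion K))
              ((φ.1 (resGalSubgroupOfEmb κ.kerSubgroup _ τ) : W.geomPrimaryTorsion p) : W.geomPoints) =
            (τ : absoluteGaloisGroup (v.adicCompletion K)) • Q - Q),
        D.toDual (j φA) ⟨s, hs⟩ =
          (PadicInt.toZModPow k (φA ⟨p ^ k • Q, hQ⟩)).val • ((((p : ℚ) ^ k)⁻¹ : ℚ) : AddCircle (1 : ℚ)))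
    (φA : ↥(⨆ n, signedLocalPoints κ (v.adicCompletion K) W ε n) →+ ℤ_[p])
    (horth : ∀ (s : W.subgroupH1 p κ.kerSubgroup), s ∈ signedSelmerInfty W κ ε →
        ∀ (φ : contOneCocycles (discreteTopRep κ.kerSubgroup (W.geomPrimaryTorsion p)))
          (Q : localPoints W (v.adicCompletion K)) (k : ℕ), oneCocycleClass _ φ = s →
          ∀ (hQ : p ^ k • Q ∈ (⨆ n, signedLocalPoints κ (v.adicCompletion K) W ε n)),
          (∀ τ : localSubgroupOfEmb κ.kerSubgroup (closureEmb (K := K) (v.adicCompletion K)),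
            pointsMapOfEmb W (closureEmb (K := K) (v.adicCompletion K))
                ((φ.1 (resGalSubgroupOfEmb κ.kerSubgroup _ τ) : W.geomPrimaryTorsion p) : W.geomPoints) =
              (τ : absoluteGaloisGroup (v.adicCompletion K)) • Q - Q) →
          PadicInt.toZModPow k (φA ⟨p ^ k • Q, hQ⟩) = 0) :
    j φA = 0 := by
  apply D.bijective.1
  rw [map_zero]
  refine AddMonoidHom.ext fun s ↦ ?_
  obtain ⟨φ, Q, k, hφ, hQ, hτ⟩ := (mem_localKummerOverOfEmb_iff _ (s : W.subgroupH1 p κ.kerSubgroup)).1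
    (SignedEC.signedSelmerInfty_le_localKummerOverOfEmb_iSup_signedLocalPoints W κ ε v hv s.2)
  rw [AddMonoidHom.zero_apply]
  exact toDual_pointsModelJ_apply_eq_zero_of_witness W p κ ε v D j hj φA s.2 φ Q k hφ hQ hτ
    (horth s s.2 φ Q k hφ hQ hτ)

/-- **(Rec) up to `p^m`** (the `2`-robust form `C(p)^m • j (col x) = 0`): if `p^m · φ_A(p^k Q) ≡ 0 (mod p^k)` on every Kummer
witness of every Selmer class, then `p^m • j₀ φ_A = 0` (apply the previous theorem to `p^m • φ_A`).
[cite: Kobayashi2003, (7.17)–(7.20) (p. 12)] [cite: Kato2004Asterisque, §17.13 (p. 279)] -/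
theorem pointsModelJ_nsmul_eq_zero_of_forall_witness (hv : (p : 𝓞 K) ∈ v.asIdeal)
    (hj : ∀ (φA : ↥(⨆ n, signedLocalPoints κ (v.adicCompletion K) W ε n) →+ ℤ_[p])
        (s : W.subgroupH1 p κ.kerSubgroup) (hs : s ∈ signedSelmerInfty W κ ε)
        (φ : contOneCocycles (discreteTopRep κ.kerSubgroup (W.geomPrimaryTorsion p)))
        (Q : localPoints W (v.adicCompletion K)) (k : ℕ)
        (_ : oneCocycleClass _ φ = s) (hQ : p ^ k • Q ∈ (⨆ n, signedLocalPoints κ (v.adicCompletion K) W ε n))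
        (_ : ∀ τ : localSubgroupOfEmb κ.kerSubgroup (closureEmb (K := K) (v.adicCompletion K)),
          pointsMapOfEmb W (closureEmb (K := K) (v.adicCompletion K))
              ((φ.1 (resGalSubgroupOfEmb κ.kerSubgroup _ τ) : W.geomPrimaryTorsion p) : W.geomPoints) =
            (τ : absoluteGaloisGroup (v.adicCompletion K)) • Q - Q),
        D.toDual (j φA) ⟨s, hs⟩ =
          (PadicInt.toZModPow k (φA ⟨p ^ k • Q, hQ⟩)).val • ((((p : ℚ) ^ k)⁻¹ : ℚ) : AddCircle (1 : ℚ)))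
    (φA : ↥(⨆ n, signedLocalPoints κ (v.adicCompletion K) W ε n) →+ ℤ_[p]) (m : ℕ)
    (horth : ∀ (s : W.subgroupH1 p κ.kerSubgroup), s ∈ signedSelmerInfty W κ ε →
        ∀ (φ : contOneCocycles (discreteTopRep κ.kerSubgroup (W.geomPrimaryTorsion p)))
          (Q : localPoints W (v.adicCompletion K)) (k : ℕ), oneCocycleClass _ φ = s →
          ∀ (hQ : p ^ k • Q ∈ (⨆ n, signedLocalPoints κ (v.adicCompletion K) W ε n)),
          (∀ τ : localSubgroupOfEmb κ.kerSubgroup (closureEmb (K := K) (v.adicCompletion K)),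
            pointsMapOfEmb W (closureEmb (K := K) (v.adicCompletion K))
                ((φ.1 (resGalSubgroupOfEmb κ.kerSubgroup _ τ) : W.geomPrimaryTorsion p) : W.geomPoints) =
              (τ : absoluteGaloisGroup (v.adicCompletion K)) • Q - Q) →
          PadicInt.toZModPow k ((p : ℤ_[p]) ^ m * φA ⟨p ^ k • Q, hQ⟩) = 0) :
    p ^ m • j φA = 0 := by
  rw [← map_nsmul]
  refine pointsModelJ_eq_zero_of_forall_witness W p κ ε v D j hv hj (p ^ m • φA) fun s hs φ Q k hφ hQ hτ ↦ ?_
  rw [AddMonoidHom.nsmul_apply, nsmul_eq_mul, Nat.cast_pow]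
  exact horth s hs φ Q k hφ hQ hτ

end Rec

/-! ## §2 (Lin): `col := q ∘ col₀` is `Λ`-linear -/

section Lin

variable {p : ℕ} [Fact p.Prime] {W : WeierstrassCurve ℚ} [W.IsElliptic] [ContinuousSMul ℤ_[p] (W.tateModule p)]
  {κ : ZpExtension ℚ p} {γ : absoluteGaloisGroup ℚ} (I : IwasawaH1Data W p κ γ)
  {E : Type} [Field E] [Algebra ℚ E] (ι : AlgebraicClosure ℚ →ₐ[ℚ] AlgebraicClosure E)
  {g : absoluteGaloisGroup E}

/-- **`col := q ∘ col₀ : 𝐇¹_Γ(T_pW) →ₗ[Λ] P` is `Λ`-LINEAR** whenever `q : Hom(E(K_∞·K_v), ℤ_p) →+ P` is `Λ`-compatible for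
Sprung's action (`q (f ⋆ z) = f • q z`, the package's clause) and `col₀ : 𝐇¹ →+ Hom(E(K_∞·K_v), ℤ_p)` is `Λ`-compatible
(`col₀ (f • x) = f ⋆ col₀ x`, `ColGlue.col_smul_eq_lambdaSMul`); `f ⋆ z = Sprung2012.lambdaSMul κ ι W hg f z`. This is the `col`
of the registered stub (R2^ι). [cite: Sprung2012, Def. 5.9 (p. 1495)] [cite: Kato2004Asterisque, §17.13 (p. 279)] -/
theorem exists_linearMap_comp_of_lambdaSMul (hg : κ.IsTopGenerator (resGalOfEmb ι g))
    {P : Type*} [AddCommGroup P] [Module (IwasawaAlgebra p) P]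
    (q : (localTowerPointsOfEmb κ ι W →+ ℤ_[p]) →+ P)
    (hq : ∀ (f : IwasawaAlgebra p) (z : localTowerPointsOfEmb κ ι W →+ ℤ_[p]), q (lambdaSMul κ ι W hg f z) = f • q z)
    (col₀ : I.H →+ (localTowerPointsOfEmb κ ι W →+ ℤ_[p]))
    (hcol₀ : ∀ (f : IwasawaAlgebra p) (x : I.H), col₀ (f • x) = lambdaSMul κ ι W hg f (col₀ x)) :
    ∃ col : I.H →ₗ[IwasawaAlgebra p] P, ∀ x, col x = q (col₀ x) :=
  ⟨{ toFun := fun x ↦ q (col₀ x)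
     map_add' := fun x x' ↦ by rw [map_add, map_add]
     map_smul' := fun f x ↦ by rw [hcol₀, hq, RingHom.id_apply] }, fun _ ↦ rfl⟩

end Lin

/-! ## §3 (Z): the zeta bound from an explicit-reciprocity-shaped identity -/

section Zeta

variable {p : ℕ} [Fact p.Prime]

/-- Off `p`, multiplying the generator by a power of `C(p)` does not change the local length:
`ℓ_𝔭(Λ/(C(p)^a · G)) = ℓ_𝔭(Λ/(G))` for `C(p) ∉ 𝔭` (`C(p)` is prime in `Λ`: `IwasawaAlgebra.prime_C`). [cite: Washington1997, §13.2] -/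
theorem lengthAt_quotient_span_C_pow_mul_eq (a : ℕ) (G : IwasawaAlgebra p) (𝔭 : PrimeSpectrum (IwasawaAlgebra p))
    (hp𝔭 : PowerSeries.C (p : ℤ_[p]) ∉ 𝔭.asIdeal) :
    lengthAt (IwasawaAlgebra p) (IwasawaAlgebra p ⧸ Ideal.span {PowerSeries.C (p : ℤ_[p]) ^ a * G}) 𝔭 =
      lengthAt (IwasawaAlgebra p) (IwasawaAlgebra p ⧸ Ideal.span {G}) 𝔭 := by
  have hC : Prime (PowerSeries.C (p : ℤ_[p]) : IwasawaAlgebra p) := IwasawaAlgebra.prime_C p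
  rw [lengthAt_quotient_span_singleton_mul G (pow_ne_zero a hC.ne_zero) 𝔭,
    lengthAt_quotient_eq_zero_of_not_le (I := Ideal.span {PowerSeries.C (p : ℤ_[p]) ^ a}) ?_, zero_add]
  rw [Ideal.span_singleton_le_iff_mem]
  exact fun h ↦ hp𝔭 (𝔭.isPrime.mem_of_pow_mem a h)

/-- **(Z) from an explicit-reciprocity-shaped identity.** If `C(p)^a · G = w · C(p)^b · L` with `w` a UNIT of `Λ`, then at every
prime `𝔭 ∌ C(p)`: `ℓ_𝔭(Λ/(G)) = ℓ_𝔭(Λ/(L))`. With `G = Col♭(col z)` for a genuine `p`-adic Euler-system class `z` and `L = L♭` this is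
the form in which Kato's explicit reciprocity law (Thm. 12.5; Kobayashi Thm. 6.3; at `p = 2` Otsuki 2009 / Sprung 2012 Def. 6.1:
`Col(z_Kato) ⊗ ℚ = (L♯, L♭)` up to a unit and a power of `p`) feeds the zeta clause of (R2^ι).
[cite: Kato2004Asterisque, Thm. 12.5 (p. 222)] [cite: Kobayashi2003, Thm. 6.3 (p. 11)] [cite: Sprung2012, Def. 6.1 (p. 1495)]
[cite: Washington1997, §13.2] -/
theorem lengthAt_quotient_span_eq_of_C_pow_mul_eq_unit_mul {G L w : IwasawaAlgebra p} (hw : IsUnit w) {a b : ℕ}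
    (h : PowerSeries.C (p : ℤ_[p]) ^ a * G = w * PowerSeries.C (p : ℤ_[p]) ^ b * L)
    (𝔭 : PrimeSpectrum (IwasawaAlgebra p)) (hp𝔭 : PowerSeries.C (p : ℤ_[p]) ∉ 𝔭.asIdeal) :
    lengthAt (IwasawaAlgebra p) (IwasawaAlgebra p ⧸ Ideal.span {G}) 𝔭 =
      lengthAt (IwasawaAlgebra p) (IwasawaAlgebra p ⧸ Ideal.span {L}) 𝔭 := by
  rw [← lengthAt_quotient_span_C_pow_mul_eq a G 𝔭 hp𝔭, h, mul_assoc, Ideal.span_singleton_mul_left_unit hw,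
    lengthAt_quotient_span_C_pow_mul_eq b L 𝔭 hp𝔭]

/-- The inequality form consumed by the zeta clause of (R2^ι): `ℓ_𝔭(Λ/(G)) ≤ ℓ_𝔭(Λ/(L))` at `𝔭 ∌ C(p)` under
`C(p)^a · G = w · C(p)^b · L`, `w ∈ Λˣ`. [cite: Kato2004Asterisque, Thm. 12.5 (p. 222)] [cite: Kobayashi2003, Thm. 6.3 (p. 11)] -/
theorem lengthAt_quotient_span_le_of_C_pow_mul_eq_unit_mul {G L w : IwasawaAlgebra p} (hw : IsUnit w) {a b : ℕ}
    (h : PowerSeries.C (p : ℤ_[p]) ^ a * G = w * PowerSeries.C (p : ℤ_[p]) ^ b * L)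
    (𝔭 : PrimeSpectrum (IwasawaAlgebra p)) (hp𝔭 : PowerSeries.C (p : ℤ_[p]) ∉ 𝔭.asIdeal) :
    lengthAt (IwasawaAlgebra p) (IwasawaAlgebra p ⧸ Ideal.span {G}) 𝔭 ≤
      lengthAt (IwasawaAlgebra p) (IwasawaAlgebra p ⧸ Ideal.span {L}) 𝔭 :=
  (lengthAt_quotient_span_eq_of_C_pow_mul_eq_unit_mul hw h 𝔭 hp𝔭).le

end Zeta

end SignedKatoOffTwo.RecInterface

end Summit.BirchSwinnertonDyer.BirchSwinnertonDyer.Theorems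

end
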